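import Summits.ValiantsHypothesis.ValiantsHypothesis.Theorems.OrderedCountWindowRungs
import HarnessLib

/-!
# Ordered count window — transfer under block-respecting substitutions (lens 6, g7, K1–K2)

The dial predicate `IsSumOrdered F N t W` ("`per_N` is a sum of `t` ORDERED column-set-multilinear
ABPs of total width `≤ W`", `Theorems/OrderedCountWindow.lean`) is stable under BLOCK-RESPECTING
PROJECTIONS of the permanent: declare some columns "variable columns" — the variable column of block
`c'` carries fresh variables `y_(c', 0), …, y_(c', n-1)` in chosen rows `ρ c' 0, …, ρ c' (n-1)` and
zeros elsewhere (different blocks MAY share rows) — and fill every other column with constants.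
The coefficient tensor of the projected permanent, `T(j) = per(M_j)` with `M_j` the constant matrix
carrying the indicator of row `ρ c' (j c')` in the variable column of block `c'`
(`transferTensor`, written as the word sum `∑_J perWord J · ∏_c M_j (J c) c`), is again a sum of `t`
ordered programs over the `d` blocks with the SAME widths and block orders induced from the `σ_i`
(`isSumOrderedT_transferTensor`; Lemma R of the workshop note RESERVOIR-g7).  Programs are recorded
LAYER-LOCALLY (`HasOsmWidthLE`: `L` layers, layer `p` reads block `κ p` or is constant), which is
exactly what a substitution produces (a constant column becomes a constant layer) and what the rank
method consumes; the dial predicate itself is the identity substitution (`isSumOrderedT_perWord`).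

Contents: `HasOsmWidthLE`, `IsSumOrderedT` (§1); `listProd_ofFn_sum`, `listProd_ofFn_smul` (§2);
`substMatrix`, `transferTensor`, `isSumOrderedT_transferTensor` (§3); `transferTensor_self`,
`isSumOrderedT_perWord` (§4); `perNotSumOrdered_of_transfer` (§5: one hard projection per exponent
gives `PerNotSumOrdered t`).
-/

noncomputable section

namespace Summit.ValiantsHypothesis.ValiantsHypothesis.Theorems.OrderedCountWindow

open Literature.Computability.AlgebraicComplexity Matrix

variable {F : Type*} [Field F]

/-! ## §1 Layer-local ordered programs, and sums of them for an arbitrary tensor -/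

/-- A tensor `T : (block ↦ letter) → F` over `d` blocks of `n` letters has a LAYER-LOCAL ORDERED
PROGRAM of width `≤ w` with `L` layers and reading map `κ` (`κ p = some c`: layer `p` reads block
`c`; `κ p = none`: layer `p` is constant): `T j = uᵀ (∏_p C p j) v` with `w × w` layer matrices
`C p j` depending on `j` only through the letter of the block read at layer `p`.
[cite: ChatterjeeKushSarafShpilka2024, Def 1 (ordered smABP; = ROABP, Remark 1)] -/
def HasOsmWidthLE {L d n : ℕ} (w : ℕ) (κ : Fin L → Option (Fin d)) (T : (Fin d → Fin n) → F) :
    Prop :=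
  ∃ (C : Fin L → (Fin d → Fin n) → Matrix (Fin w) (Fin w) F) (u v : Fin w → F),
    (∀ p j j', (∀ c, κ p = some c → j c = j' c) → C p j = C p j') ∧
      ∀ j, T j = u ⬝ᵥ ((List.ofFn fun p => C p j).prod *ᵥ v)

/-- **`T` is a sum of `t` ordered set-multilinear ABPs of total width `≤ W`**: program `i` has
`L i` layers, reads every block in exactly one of them (read-once, in the order the layers come),
has width `w i`, and `∑ w i ≤ W`. [cite: ChatterjeeKushSarafShpilka2024, Def 2 (support, total width)] -/
def IsSumOrderedT {d n : ℕ} (t W : ℕ) (T : (Fin d → Fin n) → F) : Prop :=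
  ∃ (L : Fin t → ℕ) (κ : (i : Fin t) → Fin (L i) → Option (Fin d)) (w : Fin t → ℕ)
    (B : Fin t → (Fin d → Fin n) → F),
    (∀ i c, ∃! p, κ i p = some c) ∧ (∀ i, HasOsmWidthLE (w i) (κ i) (B i)) ∧ ∑ i, w i ≤ W ∧
      ∀ j, ∑ i, B i j = T j

/-! ## §2 Two identities for ordered products of matrices -/

/-- Noncommutative distributivity: `∏_p (∑_r A p r) = ∑_J ∏_p A p (J p)` for ORDERED products.
[folklore] -/
theorem listProd_ofFn_sum {R α : Type*} [Semiring R] [Fintype α] {N : ℕ} (A : Fin N → α → R) :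
    (List.ofFn fun p => ∑ r, A p r).prod =
      ∑ J : Fin N → α, (List.ofFn fun p => A p (J p)).prod := by
  induction N with
  | zero => simp
  | succ N ih =>
    rw [List.ofFn_succ, List.prod_cons, ih (fun p => A p.succ), Finset.sum_mul_sum,
      ← Fintype.sum_prod_type']
    refine Fintype.sum_equiv (Fin.consEquiv fun _ => α) _ _ fun x => ?_
    simp only [Fin.consEquiv_apply, List.ofFn_succ, List.prod_cons, Fin.cons_zero, Fin.cons_succ]

/-- Scalars pull out of an ordered product: `∏_p (a p • X p) = (∏_p a p) • ∏_p X p`. [folklore] -/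
theorem listProd_ofFn_smul {R : Type*} [CommSemiring R] {k : Type*} [Fintype k] [DecidableEq k]
    {N : ℕ} (a : Fin N → R) (X : Fin N → Matrix k k R) :
    (List.ofFn fun p => a p • X p).prod = (∏ p, a p) • (List.ofFn X).prod := by
  induction N with
  | zero => simp
  | succ N ih =>
    rw [List.ofFn_succ, List.prod_cons, ih (fun p => a p.succ) (fun p => X p.succ), List.ofFn_succ,
      List.prod_cons, Fin.prod_univ_succ, smul_mul_assoc, mul_smul_comm, smul_smul]

/-! ## §3 Block-respecting substitutions of the permanent -/

variable {N d n : ℕ}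

/-- The constant matrix `M_j` of a block-respecting substitution: a column `c` with `γ c = some c'`
is the variable column of block `c'` and carries the indicator of the row `ρ c' (j c')`; a column
with `γ c = none` carries the constants `B · c`. [cite: ArvindRaja2016, §3 (PER under ROABP sums)] -/
def substMatrix (γ : Fin N → Option (Fin d)) (ρ : Fin d → Fin n → Fin N) (B : Fin N → Fin N → F)
    (j : Fin d → Fin n) (r c : Fin N) : F :=
  (γ c).elim (B r c) fun c' => if r = ρ c' (j c') then 1 else 0

/-- `M_j` depends on `j` in column `c` only through the letter of the block owning `c`. [folklore] -/
theorem substMatrix_congr (γ : Fin N → Option (Fin d)) (ρ : Fin d → Fin n → Fin N)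
    (B : Fin N → Fin N → F) {j j' : Fin d → Fin n} {c : Fin N}
    (h : ∀ c', γ c = some c' → j c' = j' c') (r : Fin N) :
    substMatrix γ ρ B j r c = substMatrix γ ρ B j' r c := by
  unfold substMatrix
  cases hc : γ c with
  | none => rfl
  | some c' => simp [h c' hc]

/-- The PROJECTED PERMANENT TENSOR `T(j) = per(M_j) = ∑_J perWord J · ∏_c M_j (J c) c`: the
coefficient of `∏_(c') y_(c', j c')` in `per_N` after the block-respecting substitution `(γ, ρ, B)`
(Laplace expansion along the variable columns). [cite: ArvindRaja2016, §3; Nisan1991Noncommutative, §4] -/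
def transferTensor (γ : Fin N → Option (Fin d)) (ρ : Fin d → Fin n → Fin N) (B : Fin N → Fin N → F)
    (j : Fin d → Fin n) : F :=
  ∑ J : Fin N → Fin N, NisanPermanent.perWord F N J * ∏ c, substMatrix γ ρ B j (J c) c

/-- **Transfer (Lemma R).** If `per_N` is a sum of `t` ordered programs of total width `≤ W`, then for
EVERY block-respecting substitution whose blocks own one variable column each, the projected tensor
is a sum of `t` ordered (layer-local, read-once) programs over the `d` blocks of total width `≤ W`:
substitute into each layer; a constant column gives a constant layer, the variable column of block
`c'` gives a layer reading `j c'`. [cite: ChatterjeeKushSarafShpilka2024, §1.2 (closure of ΣosmABP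
under set-multilinear projections, implicit); ArvindRaja2016, §3] -/
theorem isSumOrderedT_transferTensor {t W : ℕ} (γ : Fin N → Option (Fin d))
    (hγ : ∀ c', ∃! c, γ c = some c') (ρ : Fin d → Fin n → Fin N) (B : Fin N → Fin N → F)
    (h : IsSumOrdered F N t W) : IsSumOrderedT t W (transferTensor γ ρ B) := by
  classical
  obtain ⟨σ, w, Bt, hBt, hsum, hper⟩ := h
  choose C u v hC using hBt
  refine ⟨fun _ => N, fun i p => γ (σ i p), w, fun i j => u i ⬝ᵥ
      ((List.ofFn fun p => ∑ r, substMatrix γ ρ B j r (σ i p) • C i p r).prod *ᵥ v i),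
    fun i c' => ?_, fun i => ?_, hsum, fun j => ?_⟩
  · -- read-once: block `c'` is read exactly at the position of its variable column
    obtain ⟨c, hc, huniq⟩ := hγ c'
    refine ⟨(σ i).symm c, by simpa using hc, fun p hp => ?_⟩
    rw [← huniq (σ i p) hp, Equiv.symm_apply_apply]
  · -- each summand is a layer-local program of the same width
    refine ⟨fun p j => ∑ r, substMatrix γ ρ B j r (σ i p) • C i p r, u i, v i,
      fun p j j' hjj' => ?_, fun j => rfl⟩
    exact Finset.sum_congr rfl fun r _ => by rw [substMatrix_congr γ ρ B hjj']
  · -- the identity `∑_i (substituted program i) = T`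
    have key : ∀ i, u i ⬝ᵥ ((List.ofFn fun p =>
        ∑ r, substMatrix γ ρ B j r (σ i p) • C i p r).prod *ᵥ v i) =
        ∑ J : Fin N → Fin N, Bt i (J ∘ ⇑(σ i)) * ∏ c, substMatrix γ ρ B j (J c) c := by
      intro i
      have h1 : ∑ J : Fin N → Fin N, Bt i (J ∘ ⇑(σ i)) * ∏ c, substMatrix γ ρ B j (J c) c =
          ∑ J' : Fin N → Fin N, Bt i J' * ∏ p, substMatrix γ ρ B j (J' p) (σ i p) := by
        refine Fintype.sum_equiv ((σ i).symm.arrowCongr (Equiv.refl (Fin N))) _ _ fun J => ?_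
        have hJ : ((σ i).symm.arrowCongr (Equiv.refl (Fin N))) J = J ∘ ⇑(σ i) := by
          ext p; simp
        rw [hJ, ← Equiv.prod_comp (σ i) (fun c => substMatrix γ ρ B j (J c) c)]
        rfl
      have h2 : ∀ J' : Fin N → Fin N, Bt i J' * ∏ p, substMatrix γ ρ B j (J' p) (σ i p) =
          u i ⬝ᵥ ((List.ofFn fun p => substMatrix γ ρ B j (J' p) (σ i p) • C i p (J' p)).prod
            *ᵥ v i) := by
        intro J'
        rw [hC i J', listProd_ofFn_smul (fun p => substMatrix γ ρ B j (J' p) (σ i p))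
          (fun p => C i p (J' p)), Matrix.smul_mulVec, dotProduct_smul, smul_eq_mul, mul_comm]
      rw [h1, listProd_ofFn_sum (fun p r => substMatrix γ ρ B j r (σ i p) • C i p r),
        Matrix.sum_mulVec, dotProduct_sum]
      exact Finset.sum_congr rfl fun J' _ => (h2 J').symm
    simp only [key, transferTensor]
    rw [Finset.sum_comm]
    refine Finset.sum_congr rfl fun J _ => ?_
    rw [← Finset.sum_mul, hper J]

/-! ## §4 The dial predicate is the identity substitution -/

/-- With every column variable (`γ = some`) and the identity row maps, the projected tensor is
Nisan's word tensor of `per_N` itself. [cite: Nisan1991Noncommutative, §4] -/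
theorem transferTensor_self (B : Fin N → Fin N → F) :
    transferTensor (fun c : Fin N => some c) (fun _ r => r) B = NisanPermanent.perWord F N := by
  classical
  funext j
  unfold transferTensor substMatrix
  simp only [Option.elim_some, Fintype.prod_boole]
  have hiff : ∀ J : Fin N → Fin N, (∀ c, J c = j c) ↔ J = j := fun J => funext_iff.symm
  simp_rw [hiff]
  simp

/-- `IsSumOrdered` implies the layer-local form `IsSumOrderedT` for the word tensor of `per_N`
(the converse — merging constant layers — also holds but is not needed by the rank method).
[cite: ChatterjeeKushSarafShpilka2024, Def 2] -/
theorem isSumOrderedT_perWord {t W : ℕ} (h : IsSumOrdered F N t W) :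
    IsSumOrderedT t W (NisanPermanent.perWord F N) := by
  rw [← transferTensor_self (fun _ _ => (0 : F))]
  exact isSumOrderedT_transferTensor _ (fun c' => ⟨c', rfl, fun c h => Option.some_injective _ h⟩)
    _ _ h

/-! ## §5 How the dial uses the transfer: hardness of ONE projection gives `A_t` -/

/-- **Reservoir principle.** To prove `A_t = PerNotSumOrdered t` it suffices, for every exponent `c`,
to exhibit ONE block-respecting projection of some `per_N` whose tensor is not a sum of `t N` ordered
programs of total width `≤ N ^ c + c`. [cite: ArvindRaja2016, §3 (open problem: poly(n) many ROABPs
for PER); ChatterjeeKushSarafShpilka2024, Thm 3 (the method for their `F_(n,n)`)] -/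
theorem perNotSumOrdered_of_transfer (t : ℕ → ℕ)
    (h : ∀ c : ℕ, ∃ (N d n : ℕ) (γ : Fin N → Option (Fin d)) (ρ : Fin d → Fin n → Fin N)
      (B : Fin N → Fin N → ℂ), (∀ c', ∃! col, γ col = some c') ∧
        ¬ IsSumOrderedT (t N) (N ^ c + c) (transferTensor γ ρ B)) :
    PerNotSumOrdered t := by
  intro c
  obtain ⟨N, d, n, γ, ρ, B, hγ, hnot⟩ := h c
  exact ⟨N, fun hs => hnot (isSumOrderedT_transferTensor γ hγ ρ B hs)⟩

/-- The layer-local form of the dial itself: if for every exponent some `perWord ℂ N` is not a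
`(t N, N ^ c + c)`-sum of layer-local ordered programs, then `A_t`. [folklore] -/
theorem perNotSumOrdered_of_perWord (t : ℕ → ℕ)
    (h : ∀ c : ℕ, ∃ N : ℕ, ¬ IsSumOrderedT (t N) (N ^ c + c) (NisanPermanent.perWord ℂ N)) :
    PerNotSumOrdered t := by
  intro c
  obtain ⟨N, hN⟩ := h c
  exact ⟨N, fun hs => hN (isSumOrderedT_perWord hs)⟩

end Summit.ValiantsHypothesis.ValiantsHypothesis.Theorems.OrderedCountWindow
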